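import Summits.NavierStokesRegularity.NavierStokesRegularity.Theorems.CertifiedBlowupCertifiedBlowupVorticityRateBlowupVelocityExponent
import Summits.NavierStokesRegularity.NavierStokesRegularity.Theorems.CertifiedBlowupCertifiedBlowupVorticityRateBlowupSlabFloor
import HarnessLib

/-!
# Certificate class `CertifiedBlowupVorticityRateBlowup` (stmt-NavierStokesRegularity-8639): THE MODULATION LAW UNDER AN
# ENSTROPHY SLAB-GRÖNWALL COEFFICIENT `κ` — enstrophy `≤ (T − t)^{−κC}`, velocity `≤ K(T − t)^{−(1+κC)/3}`, vertex distance
# `d ≤ K′(T − t)^{(1−2κC)/3}`, and `C > 1/(2κ)` STRICTLY — deposit 8, parametrically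

Theorems file landed `--supports stmt-NavierStokesRegularity-8639` (cell `ns-blowup`, GROUP B zone Z1 → the certificate
crux; tenth crux-side deposit of the zone-Z1 seat, lead letter (ls); the corollary file of the ninth deposit `…SlabFloor`).
Deposit 8 (`…VorticityRateBlowupVelocityExponent`) derived the power law `∫|ω(t)|² ≤ ∫|ω(t₀)|²((T − t₀)/(T − t))^{2C}`, the
velocity bound `(T − t)^{1+2C}‖u‖³ ≤ K`, the vertex-distance bound `d³ ≲ (T − t)^{1−4C}` and the strict floor `C > 1/4` from
the slab Grönwall with coefficient `2`. Here the coefficient is a PARAMETER `κ > 0`, under the slab hypothesis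

  `(S_κ)`: for all `0 ≤ t₁ < t₂ < T` and `Ω` with `‖curl u(t, x)‖ ≤ Ω` on `[t₁, t₂] × ℝ³`,
  `∫|curl u(t₂)|² ≤ (∫|curl u(t₁)|²) · exp(κ Ω (t₂ − t₁))`

(spelled out in every statement; `κ = 2` is the tree's `slab_gronwall_two`, `κ = 2/√3` the strain form of the Literature
file `VorticitySupEnstrophyGronwallSharp`, instantiated in the closing file `…ConstantFloorSharp`). For a witness
`(ν, T, u, p)` of the certificate class obeying `(S_κ)` with `(T − t)‖curl u(t, x)‖ ≤ C` on `[t₀, T) × ℝ³`: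

* `integral_sq_norm_curl_le_rpow_of_slab` — THE POWER LAW: `∫|ω(t)|² ≤ ∫|ω(t₀)|² · ((T − t₀)/(T − t))^{κC}` for all
  `t ∈ [t₀, T)` (the ninth deposit's geometric bound with `q = r^{1/n}`, `n(r^{1/n} − 1) → log r`);
* `cube_norm_le_of_slab` — `(T − t)^{1+κC} ‖u(t, x)‖³ ≤ 8(4π)⁻¹ C (T − t₀)^{κC} ∫|ω(t₀)|²` (Biot–Savart:
  `biotSavart_curl_eq_self_of_lintegral_sq_lt_top`, `norm_biotSavart_le_rpow_third`, by name as in deposit 8);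
* `gauge_vertex_distance_cube_le_of_slab` — at a gauge time `tₖ` with `(λₖ/ν)‖u(tₖ, xₖ)‖ ≥ 1/2`:
  `dₖ³ ≤ (64/ν³) K² (T − tₖ)^{1 − 2κC}`, `dₖ = ν(T − tₖ)/λₖ²`;
* `vorticityRate_witness_const_gt_of_slab` — **`C > 1/(2κ)` STRICTLY**: at `C = 1/(2κ)` the exponent vanishes and `dₖ`
  is bounded along every gauge sequence with near-max points, against deposit 7's KNSS-forced Type-II gauge sequence
  `vorticityRate_witness_typeII_gauge_uniformStream` (`dₖ → ∞`); `vorticityRate_witness_velocity_exponent_of_slab` —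
  assembled;
* the `κ = 2` INSTANCE reproduces deposit 8's `vorticityRate_witness_const_gt_quarter` (`example`s below).

ZONE-Z1 READING (TEMPLATE T1.2, quantified by `C_ω` AND the kernel slab constant `κ`): `γ_u ≤ (1 + κC_ω)/3`,
`λ_a(t) = ν/‖u(t)‖_∞ ≳ (T − t)^{(1+κC_ω)/3}`, `d(t) ≲ (T − t)^{(1−2κC_ω)/3}`; K-AUDIT HOOK: a candidate printing
`‖u‖_∞ ∼ (T − t)^{−γ}` needs `C_ω ≥ (3γ − 1)/κ` (strain constant `κ = 2/√3`: `C_ω ≥ (√3/2)(3γ − 1)`). No new definitions, no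
named-fact hypotheses, no `sorry`. WHAT THIS IS NOT: not a blow-up or regularity claim — a priori inequalities about a
HYPOTHETICAL witness; crux 8639, crux 8640 and (AX-L) untouched. Author: ns-blowup-profile-eng-1 g12, 2026-08-27.

## References
* J. C. Robinson, J. L. Rodrigo, W. Sadowski, CUP 2016, Thm 12.3 (12.11)–(12.12). [RobinsonRodrigoSadowski2016]
* A. J. Majda, A. L. Bertozzi, *Vorticity and Incompressible Flow*, CUP 2002, §2.4.1 Prop. 2.16, §4.1.3 (4.30). [MajdaBertozziCUP2002]
* G. Koch, N. Nadirashvili, G. Seregin, V. Šverák, Acta Math. 203 (2009), Thms 6.1–6.2. [KochNadirashviliSereginSverak2009]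
-/

-- the summit and its single problem share the name (D-0017 nested layout)
set_option linter.dupNamespace false

noncomputable section

open MeasureTheory Set Function Filter Topology Metric
open scoped ENNReal NNReal

namespace Summit.NavierStokesRegularity.NavierStokesRegularity.Theorems.CertifiedBlowupVorticityRateBlowup.SlabFloor

open Literature.Analysis.FluidPDE
open Summit.NavierStokesRegularity.NavierStokesRegularity.Theorems.CertifiedBlowupAxisymBlowup.CompactAmplification
open Summit.NavierStokesRegularity.NavierStokesRegularity.Theorems.CertifiedBlowupVorticityRateBlowup.InnerObject
open Summit.NavierStokesRegularity.NavierStokesRegularity.Theorems.CertifiedBlowupVorticityRateBlowup.ConstantFloor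

variable {ν T : ℝ} {u : ℝ → EuclideanSpace ℝ (Fin 3) → EuclideanSpace ℝ (Fin 3)}
  {p : ℝ → EuclideanSpace ℝ (Fin 3) → ℝ}

/-! ### The power law for all times under `(S_κ)` -/

/-- **The power law for all times under `(S_κ)`.** If `u` obeys the slab Grönwall `(S_κ)` on `[0, T)` and
`(T − t)‖curl u(t, x)‖ ≤ C` on `[t₀, T) × ℝ³` (`0 ≤ t₀ < T`), then for every `t ∈ [t₀, T)`:
`∫|curl u(t)|² ≤ (∫|curl u(t₀)|²) · ((T − t₀)/(T − t))^{κC}`. [cite: RobinsonRodrigoSadowski2016, Thm 12.3 (12.12)] -/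
theorem integral_sq_norm_curl_le_rpow_of_slab {κ : ℝ}
    (hslab : ∀ ⦃t₁ t₂ Ω : ℝ⦄, 0 ≤ t₁ → t₁ < t₂ → t₂ < T → (∀ t ∈ Icc t₁ t₂, ∀ x, ‖curl (u t) x‖ ≤ Ω) →
      ∫ x, ‖curl (u t₂) x‖ ^ 2 ≤ (∫ x, ‖curl (u t₁) x‖ ^ 2) * Real.exp (κ * Ω * (t₂ - t₁)))
    {C t₀ : ℝ} (ht₀ : 0 ≤ t₀) (ht₀T : t₀ < T)
    (hω : ∀ t ∈ Ico t₀ T, ∀ x, (T - t) * ‖curl (u t) x‖ ≤ C) {t : ℝ} (ht : t ∈ Ico t₀ T) :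
    ∫ x, ‖curl (u t) x‖ ^ 2 ≤ (∫ x, ‖curl (u t₀) x‖ ^ 2) * ((T - t₀) / (T - t)) ^ (κ * C) := by
  set E₀ : ℝ := ∫ x, ‖curl (u t₀) x‖ ^ 2 with hE₀
  have hE₀0 : 0 ≤ E₀ := integral_nonneg fun x => sq_nonneg _
  rcases eq_or_lt_of_le ht.1 with heq | hlt
  · rw [← heq, div_self (sub_pos.2 ht₀T).ne', Real.one_rpow, mul_one]
  set r : ℝ := (T - t₀) / (T - t) with hr
  have hTt : 0 < T - t := sub_pos.2 ht.2
  have hr1 : 1 < r := by rw [hr, one_lt_div hTt]; linarith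
  have hr0 : 0 < r := by linarith
  have hbound : ∀ n : ℕ, 0 < n →
      ∫ x, ‖curl (u t) x‖ ^ 2 ≤ E₀ * Real.exp (κ * C * ((n : ℝ) * (r ^ (1 / (n : ℝ)) - 1))) := by
    intro n hn
    have hn0 : (0 : ℝ) < n := by exact_mod_cast hn
    set q : ℝ := r ^ (1 / (n : ℝ)) with hq
    have hq1 : 1 < q := Real.one_lt_rpow hr1 (by positivity)
    have hqn : q ^ n = r := by
      rw [hq, ← Real.rpow_natCast, ← Real.rpow_mul hr0.le, one_div_mul_cancel hn0.ne', Real.rpow_one]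
    have htn : T - (T - t₀) / q ^ n = t := by
      rw [hqn, hr, div_div_eq_mul_div, mul_div_cancel_left₀ (T - t) (sub_pos.2 ht₀T).ne']
      ring
    have h := integral_sq_norm_curl_geometric_of_slab hslab ht₀ ht₀T hω hq1 n
    rw [htn] at h
    refine h.trans (le_of_eq ?_)
    rw [hE₀, ← Real.exp_nat_mul]
    ring_nf
  have hlim : Tendsto (fun n : ℕ => E₀ * Real.exp (κ * C * ((n : ℝ) * (r ^ (1 / (n : ℝ)) - 1)))) atTop
      (𝓝 (E₀ * Real.exp (κ * C * Real.log r))) :=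
    ((Real.continuous_exp.tendsto _).comp
      ((tendsto_nat_mul_rpow_inv_sub_one hr0).const_mul (κ * C))).const_mul E₀
  have hle : ∫ x, ‖curl (u t) x‖ ^ 2 ≤ E₀ * Real.exp (κ * C * Real.log r) :=
    ge_of_tendsto hlim ((eventually_gt_atTop 0).mono fun n hn => hbound n hn)
  rwa [show Real.exp (κ * C * Real.log r) = r ^ (κ * C) by rw [Real.rpow_def_of_pos hr0, mul_comm]] at hle

/-! ### The velocity bound under `(S_κ)` -/

/-- **`(T − t)^{1+κC} ‖u(t, x)‖³ ≤ 8(4π)⁻¹ C (T − t₀)^{κC} ∫|ω(t₀)|²`** for a witness of the crux obeying `(S_κ)` with the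
rate on `[t₀, T)`: the slice is the Biot–Savart velocity of its vorticity, so
`‖u(t, x)‖ ≤ 2(4π)^{−1/3}‖ω(t)‖_∞^{1/3}(∫|ω(t)|²)^{1/3}`; cube, insert `‖ω(t)‖_∞ ≤ C/(T − t)` and the power law.
[cite: MajdaBertozziCUP2002, §2.4.1 Prop. 2.16 and §4.1.3 (4.30)] -/
theorem cube_norm_le_of_slab (hν : 0 < ν) (hT : 0 < T) (hmax : IsMaximalSmoothSolution ν 0 u p T)
    (hLH : IsLerayHopfOn T ν 0 (u 0) u) (hdec : HasRapidSpatialDecay (u 0)) {κ : ℝ}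
    (hslab : ∀ ⦃t₁ t₂ Ω : ℝ⦄, 0 ≤ t₁ → t₁ < t₂ → t₂ < T → (∀ t ∈ Icc t₁ t₂, ∀ x, ‖curl (u t) x‖ ≤ Ω) →
      ∫ x, ‖curl (u t₂) x‖ ^ 2 ≤ (∫ x, ‖curl (u t₁) x‖ ^ 2) * Real.exp (κ * Ω * (t₂ - t₁)))
    {C t₀ : ℝ} (ht₀ : 0 ≤ t₀) (ht₀T : t₀ < T) (hω : ∀ t ∈ Ico t₀ T, ∀ x, (T - t) * ‖curl (u t) x‖ ≤ C)
    {t : ℝ} (ht : t ∈ Ico t₀ T) (x : EuclideanSpace ℝ (Fin 3)) :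
    (T - t) ^ (1 + κ * C) * ‖u t x‖ ^ 3 ≤
      8 * (4 * Real.pi)⁻¹ * C * (T - t₀) ^ (κ * C) * ∫ y, ‖curl (u t₀) y‖ ^ 2 := by
  have hreg := hasBoundedSobolevNormsOn_before_of_lerayHopf_classical hν hT hmax.1 hLH hdec
  have htT : t ∈ Ico 0 T := ⟨ht₀.trans ht.1, ht.2⟩
  have hTt : 0 < T - t := sub_pos.2 ht.2
  have hTt₀ : 0 < T - t₀ := sub_pos.2 ht₀T
  have hC0 : 0 ≤ C := le_trans (mul_nonneg hTt₀.le (norm_nonneg _)) (hω t₀ ⟨le_rfl, ht₀T⟩ 0)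
  set T'' : ℝ := (t + T) / 2 with hT''
  have hT''T : T'' < T := by rw [hT'']; linarith [ht.2]
  have hB : HasBoundedSobolevNormsOn (Icc 0 T'') u := hreg T'' hT''T
  have htS : t ∈ Icc 0 T'' := ⟨htT.1, by rw [hT'']; linarith [ht.2]⟩
  have hvt := hmax.1.contDiff_velocity htT
  have hv2 : ∫⁻ y, ‖u t y‖ₑ ^ 2 < ⊤ := by
    obtain ⟨C0, hC0'⟩ := hB 0
    refine lt_of_le_of_lt (le_of_eq (lintegral_congr fun y => ?_)) ((hC0' t htS).trans_lt ENNReal.coe_lt_top)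
    rw [← ofReal_norm, ← ofReal_norm, norm_iteratedFDeriv_zero]
  have hfin1 : ∫⁻ y, ‖iteratedFDeriv ℝ 1 (u t) y‖ₑ ^ 2 < ⊤ := by
    obtain ⟨C1, hC1⟩ := hB 1
    exact (hC1 t htS).trans_lt ENNReal.coe_lt_top
  have hω2 : ∫⁻ y, ‖curl (u t) y‖ₑ ^ 2 < ⊤ :=
    lt_of_le_of_lt (lintegral_curl_sq_le (u t)) (ENNReal.mul_lt_top ENNReal.ofReal_lt_top hfin1)
  have hωc : Continuous (curl (u t)) := continuous_curl (hvt.of_le (by norm_cast))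
  have hωI : Integrable fun y => ‖curl (u t) y‖ ^ 2 := integrable_sq_norm_of_lintegral_lt_top hωc hω2
  have hrep : biotSavart (curl (u t)) = u t :=
    biotSavart_curl_eq_self_of_lintegral_sq_lt_top (hvt.of_le (by norm_cast)) (hmax.1.divFree t htT) hv2 hω2
  have hM : ∀ y, ‖curl (u t) y‖ ≤ C / (T - t) := fun y => by
    rw [le_div_iff₀ hTt, mul_comm]
    exact hω t ht y
  set E : ℝ := ∫ y, ‖curl (u t) y‖ ^ 2 with hE
  have hE0 : 0 ≤ E := integral_nonneg fun y => sq_nonneg _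
  have hbs := norm_biotSavart_le_rpow_third hωc.aestronglyMeasurable hM hωI x
  rw [hrep] at hbs
  have hM0 : 0 ≤ C / (T - t) := div_nonneg hC0 hTt.le
  have hpi : 0 < (4 * Real.pi)⁻¹ := by positivity
  have hcube : ‖u t x‖ ^ 3 ≤ 8 * (4 * Real.pi)⁻¹ * (C / (T - t)) * E := by
    have h3 := pow_le_pow_left₀ (norm_nonneg _) hbs 3
    refine h3.trans (le_of_eq ?_)
    have hc : ∀ a : ℝ, 0 ≤ a → (a ^ (1 / 3 : ℝ)) ^ 3 = a := fun a ha => by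
      rw [← Real.rpow_natCast, ← Real.rpow_mul ha]; norm_num
    calc (2 * ((4 * Real.pi)⁻¹) ^ (1 / 3 : ℝ) * (C / (T - t)) ^ (1 / 3 : ℝ) * E ^ (1 / 3 : ℝ)) ^ 3
        = 8 * ((4 * Real.pi)⁻¹ ^ (1 / 3 : ℝ)) ^ 3 * ((C / (T - t)) ^ (1 / 3 : ℝ)) ^ 3 * (E ^ (1 / 3 : ℝ)) ^ 3 := by
          ring
      _ = 8 * (4 * Real.pi)⁻¹ * (C / (T - t)) * E := by rw [hc _ hpi.le, hc _ hM0, hc _ hE0]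
  have hEle : E ≤ (∫ y, ‖curl (u t₀) y‖ ^ 2) * ((T - t₀) / (T - t)) ^ (κ * C) :=
    integral_sq_norm_curl_le_rpow_of_slab hslab ht₀ ht₀T hω ht
  set E₀ : ℝ := ∫ y, ‖curl (u t₀) y‖ ^ 2 with hE₀
  have hE₀0 : 0 ≤ E₀ := integral_nonneg fun y => sq_nonneg _
  have hsplit : (T - t) ^ (1 + κ * C) = (T - t) * (T - t) ^ (κ * C) := by
    rw [Real.rpow_add hTt, Real.rpow_one]
  have hdiv : ((T - t₀) / (T - t)) ^ (κ * C) = (T - t₀) ^ (κ * C) / (T - t) ^ (κ * C) :=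
    Real.div_rpow hTt₀.le hTt.le _
  have hpow0 : 0 < (T - t) ^ (κ * C) := Real.rpow_pos_of_pos hTt _
  calc (T - t) ^ (1 + κ * C) * ‖u t x‖ ^ 3
      ≤ (T - t) ^ (1 + κ * C) * (8 * (4 * Real.pi)⁻¹ * (C / (T - t)) * E) :=
        mul_le_mul_of_nonneg_left hcube (Real.rpow_nonneg hTt.le _)
    _ ≤ (T - t) ^ (1 + κ * C) * (8 * (4 * Real.pi)⁻¹ * (C / (T - t)) * (E₀ * ((T - t₀) / (T - t)) ^ (κ * C))) := by
        gcongr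
    _ = 8 * (4 * Real.pi)⁻¹ * C * (T - t₀) ^ (κ * C) * E₀ := by
        rw [hsplit, hdiv]
        field_simp

/-! ### The modulation law under `(S_κ)` -/

/-- **The dimensionless vertex distance at a gauge time, under `(S_κ)`.** If moreover `tₖ ∈ [t₀, T)`, `λₖ > 0`, and at some
point `(λₖ/ν)‖u(tₖ, xₖ)‖ ≥ 1/2`, then `dₖ = ν(T − tₖ)/λₖ²` satisfies
`dₖ³ ≤ (64/ν³) · (8(4π)⁻¹ C (T − t₀)^{κC} ∫|ω(t₀)|²)² · (T − tₖ)^{1 − 2κC}`. [new here — elementary] -/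
theorem gauge_vertex_distance_cube_le_of_slab (hν : 0 < ν) (hT : 0 < T) (hmax : IsMaximalSmoothSolution ν 0 u p T)
    (hLH : IsLerayHopfOn T ν 0 (u 0) u) (hdec : HasRapidSpatialDecay (u 0)) {κ : ℝ}
    (hslab : ∀ ⦃t₁ t₂ Ω : ℝ⦄, 0 ≤ t₁ → t₁ < t₂ → t₂ < T → (∀ t ∈ Icc t₁ t₂, ∀ x, ‖curl (u t) x‖ ≤ Ω) →
      ∫ x, ‖curl (u t₂) x‖ ^ 2 ≤ (∫ x, ‖curl (u t₁) x‖ ^ 2) * Real.exp (κ * Ω * (t₂ - t₁)))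
    {C t₀ : ℝ} (ht₀ : 0 ≤ t₀) (ht₀T : t₀ < T) (hω : ∀ t ∈ Ico t₀ T, ∀ x, (T - t) * ‖curl (u t) x‖ ≤ C)
    {tk lam : ℝ} (htk : tk ∈ Ico t₀ T) (hlam : 0 < lam) {xk : EuclideanSpace ℝ (Fin 3)}
    (hnear : 1 / 2 ≤ lam / ν * ‖u tk xk‖) :
    (ν * (T - tk) / lam ^ 2) ^ 3 ≤
      64 / ν ^ 3 * (8 * (4 * Real.pi)⁻¹ * C * (T - t₀) ^ (κ * C) * ∫ y, ‖curl (u t₀) y‖ ^ 2) ^ 2 *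
        (T - tk) ^ (1 - 2 * κ * C) := by
  set K : ℝ := 8 * (4 * Real.pi)⁻¹ * C * (T - t₀) ^ (κ * C) * ∫ y, ‖curl (u t₀) y‖ ^ 2 with hK
  have hTt : 0 < T - tk := sub_pos.2 htk.2
  have hcube := cube_norm_le_of_slab hν hT hmax hLH hdec hslab ht₀ ht₀T hω htk xk
  rw [← hK] at hcube
  set U : ℝ := ‖u tk xk‖ with hU
  have hU0 : 0 ≤ U := norm_nonneg _
  have hνlam : ν / lam ≤ 2 * U := by
    rw [div_le_iff₀ hlam]
    have h := hnear
    rw [div_mul_eq_mul_div, le_div_iff₀ hν] at h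
    linarith
  have hd' : ν * (T - tk) / lam ^ 2 ≤ 4 * (T - tk) * U ^ 2 / ν := by
    have h1 : ν * (T - tk) / lam ^ 2 = (T - tk) * (ν / lam) ^ 2 / ν := by
      field_simp
    rw [h1]
    refine div_le_div_of_nonneg_right ?_ hν.le
    have h2 : (ν / lam) ^ 2 ≤ (2 * U) ^ 2 := pow_le_pow_left₀ (div_nonneg hν.le hlam.le) hνlam 2
    nlinarith [h2, hTt.le]
  have hd0 : 0 ≤ ν * (T - tk) / lam ^ 2 := by positivity
  have hU6 : ((T - tk) ^ (1 + κ * C)) ^ 2 * U ^ 6 ≤ K ^ 2 := by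
    have h := pow_le_pow_left₀ (by positivity) hcube 2
    calc ((T - tk) ^ (1 + κ * C)) ^ 2 * U ^ 6 = ((T - tk) ^ (1 + κ * C) * U ^ 3) ^ 2 := by ring
      _ ≤ K ^ 2 := h
  have hsplit : ((T - tk) ^ (1 + κ * C)) ^ 2 * (T - tk) ^ (1 - 2 * κ * C) = (T - tk) ^ (3 : ℕ) := by
    rw [← Real.rpow_natCast ((T - tk) ^ (1 + κ * C)) 2, ← Real.rpow_mul hTt.le, ← Real.rpow_add hTt,
      ← Real.rpow_natCast (T - tk) 3]
    congr 1
    push_cast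
    ring
  calc (ν * (T - tk) / lam ^ 2) ^ 3 ≤ (4 * (T - tk) * U ^ 2 / ν) ^ 3 := pow_le_pow_left₀ hd0 hd' 3
    _ = 64 / ν ^ 3 * ((T - tk) ^ (3 : ℕ) * U ^ 6) := by ring
    _ = 64 / ν ^ 3 * ((((T - tk) ^ (1 + κ * C)) ^ 2 * U ^ 6) * (T - tk) ^ (1 - 2 * κ * C)) := by
        rw [← hsplit]; ring
    _ ≤ 64 / ν ^ 3 * (K ^ 2 * (T - tk) ^ (1 - 2 * κ * C)) := by
        gcongr
    _ = 64 / ν ^ 3 * K ^ 2 * (T - tk) ^ (1 - 2 * κ * C) := by ring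

/-! ### Assembled for the witnesses of the certificate class -/

/-- **`C > 1/(2κ)` STRICTLY for every witness obeying `(S_κ)`** (`κ > 0`). The ninth deposit gives `C ≥ 1/(2κ)`. If
`C = 1/(2κ)`, the exponent `1 − 2κC` vanishes and `gauge_vertex_distance_cube_le_of_slab` bounds `dₖ³` uniformly along
ANY gauge sequence with near-max points; but deposit 7 (`vorticityRate_witness_typeII_gauge_uniformStream`, KNSS)
provides a gauge sequence with `dₖ → ∞`. [cite: KochNadirashviliSereginSverak2009, Thms 6.1–6.2] -/
theorem vorticityRate_witness_const_gt_of_slab (hν : 0 < ν) (hT : 0 < T)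
    (hmax : IsMaximalSmoothSolution ν 0 u p T) (hLH : IsLerayHopfOn T ν 0 (u 0) u)
    (hdec : HasRapidSpatialDecay (u 0)) (haxi : IsAxisymmetric (u 0)) {κ : ℝ} (hκ : 0 < κ)
    (hslab : ∀ ⦃t₁ t₂ Ω : ℝ⦄, 0 ≤ t₁ → t₁ < t₂ → t₂ < T → (∀ t ∈ Icc t₁ t₂, ∀ x, ‖curl (u t) x‖ ≤ Ω) →
      ∫ x, ‖curl (u t₂) x‖ ^ 2 ≤ (∫ x, ‖curl (u t₁) x‖ ^ 2) * Real.exp (κ * Ω * (t₂ - t₁)))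
    {C : ℝ} (hrate : ∀ᶠ t in 𝓝[<] T, ∀ x : EuclideanSpace ℝ (Fin 3), (T - t) * ‖curl (u t) x‖ ≤ C) :
    1 / (2 * κ) < C := by
  have hge := vorticityRate_witness_const_ge_of_slab hν hT hmax hLH hdec haxi hκ hslab hrate
  rcases lt_or_eq_of_le hge with hlt | heq
  · exact hlt
  exfalso
  obtain ⟨l, hlT, hl⟩ := mem_nhdsLT_iff_exists_Ioo_subset.1 hrate
  have hlT' : l < T := hlT
  set t₀ : ℝ := max 0 ((l + T) / 2) with ht₀
  have ht₀0 : 0 ≤ t₀ := le_max_left _ _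
  have ht₀T : t₀ < T := max_lt hT (by linarith)
  have hlt₀ : l < t₀ := lt_of_lt_of_le (by linarith) (le_max_right _ _)
  have hω : ∀ t ∈ Ico t₀ T, ∀ x, (T - t) * ‖curl (u t) x‖ ≤ C := fun t ht =>
    hl ⟨lt_of_lt_of_le hlt₀ ht.1, ht.2⟩
  obtain ⟨tn, lamn, cn, xn, φ, W, htn, htT, hlam, -, -, hnear, -, -, -, -, -, hII, -⟩ :=
    vorticityRate_witness_typeII_gauge_uniformStream hν hT hmax hLH hdec haxi ⟨C, hrate⟩
  set K : ℝ := 8 * (4 * Real.pi)⁻¹ * C * (T - t₀) ^ (κ * C) * ∫ y, ‖curl (u t₀) y‖ ^ 2 with hK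
  have hev1 : ∀ᶠ k in atTop, t₀ ≤ tn k := htT.eventually (eventually_ge_nhds ht₀T)
  have hev2 : ∀ᶠ k in atTop, 1 / 2 ≤ lamn k / ν * ‖u (tn k) (xn k)‖ :=
    hnear.eventually (eventually_ge_nhds (by norm_num : (1 : ℝ) / 2 < 1))
  have hbig : ∀ᶠ k in atTop, 64 / ν ^ 3 * K ^ 2 + 1 ≤ ν * (T - tn k) / lamn k ^ 2 :=
    hII.eventually (eventually_ge_atTop _)
  obtain ⟨k, hk1, hk2, hk3⟩ := (hev1.and (hev2.and hbig)).exists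
  have hd := gauge_vertex_distance_cube_le_of_slab hν hT hmax hLH hdec hslab ht₀0 ht₀T hω ⟨hk1, (htn k).2⟩
    (hlam k) hk2
  have hexp0 : (1 : ℝ) - 2 * κ * C = 0 := by
    rw [← heq]; field_simp; ring
  rw [← hK, hexp0, Real.rpow_zero, mul_one] at hd
  set d : ℝ := ν * (T - tn k) / lamn k ^ 2 with hdd
  have hM0 : 0 ≤ 64 / ν ^ 3 * K ^ 2 := by positivity
  have hd1 : 1 ≤ d := by linarith
  have hd3 : d ≤ d ^ 3 := by
    calc d = d * 1 * 1 := by ring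
      _ ≤ d * d * d := by gcongr
      _ = d ^ 3 := by ring
  linarith

/-- **CERTIFICATE-CLASS WITNESSES OBEYING `(S_κ)`: THE VELOCITY RATE EXPONENT IS AT MOST `(1 + κC)/3`.** For every
`(ν, T, u, p)` of the certificate class obeying `(S_κ)` (`κ > 0`) and every `C` with `(T − t)‖curl u(t, x)‖ ≤ C` near
`T⁻`: `C > 1/(2κ)`, and there are `t₀ ∈ [0, T)` and `K ≥ 0` with `(T − t)^{1+κC}‖u(t, x)‖³ ≤ K` for all `t ∈ [t₀, T)`
and all `x`. [cite: MajdaBertozziCUP2002, §4.1.3 (4.30); KochNadirashviliSereginSverak2009, Thms 6.1–6.2] -/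
theorem vorticityRate_witness_velocity_exponent_of_slab (hν : 0 < ν) (hT : 0 < T)
    (hmax : IsMaximalSmoothSolution ν 0 u p T) (hLH : IsLerayHopfOn T ν 0 (u 0) u)
    (hdec : HasRapidSpatialDecay (u 0)) (haxi : IsAxisymmetric (u 0)) {κ : ℝ} (hκ : 0 < κ)
    (hslab : ∀ ⦃t₁ t₂ Ω : ℝ⦄, 0 ≤ t₁ → t₁ < t₂ → t₂ < T → (∀ t ∈ Icc t₁ t₂, ∀ x, ‖curl (u t) x‖ ≤ Ω) →
      ∫ x, ‖curl (u t₂) x‖ ^ 2 ≤ (∫ x, ‖curl (u t₁) x‖ ^ 2) * Real.exp (κ * Ω * (t₂ - t₁)))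
    {C : ℝ} (hrate : ∀ᶠ t in 𝓝[<] T, ∀ x : EuclideanSpace ℝ (Fin 3), (T - t) * ‖curl (u t) x‖ ≤ C) :
    1 / (2 * κ) < C ∧ ∃ t₀ ∈ Ico 0 T, ∃ K : ℝ, 0 ≤ K ∧
      ∀ t ∈ Ico t₀ T, ∀ x : EuclideanSpace ℝ (Fin 3), (T - t) ^ (1 + κ * C) * ‖u t x‖ ^ 3 ≤ K := by
  refine ⟨vorticityRate_witness_const_gt_of_slab hν hT hmax hLH hdec haxi hκ hslab hrate, ?_⟩
  obtain ⟨l, hlT, hl⟩ := mem_nhdsLT_iff_exists_Ioo_subset.1 hrate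
  have hlT' : l < T := hlT
  set t₀ : ℝ := max 0 ((l + T) / 2) with ht₀
  have ht₀0 : 0 ≤ t₀ := le_max_left _ _
  have ht₀T : t₀ < T := max_lt hT (by linarith)
  have hlt₀ : l < t₀ := lt_of_lt_of_le (by linarith) (le_max_right _ _)
  have hω : ∀ t ∈ Ico t₀ T, ∀ x, (T - t) * ‖curl (u t) x‖ ≤ C := fun t ht =>
    hl ⟨lt_of_lt_of_le hlt₀ ht.1, ht.2⟩
  have hC0 : 0 ≤ C := le_trans (mul_nonneg (sub_pos.2 ht₀T).le (norm_nonneg _)) (hω t₀ ⟨le_rfl, ht₀T⟩ 0)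
  have hE₀0 : 0 ≤ ∫ y, ‖curl (u t₀) y‖ ^ 2 := integral_nonneg fun y => sq_nonneg _
  refine ⟨t₀, ⟨ht₀0, ht₀T⟩, 8 * (4 * Real.pi)⁻¹ * C * (T - t₀) ^ (κ * C) * ∫ y, ‖curl (u t₀) y‖ ^ 2,
    mul_nonneg (mul_nonneg (by positivity) (Real.rpow_nonneg (sub_pos.2 ht₀T).le _)) hE₀0, fun t ht x => ?_⟩
  exact cube_norm_le_of_slab hν hT hmax hLH hdec hslab ht₀0 ht₀T hω ht x

/-! ### The instance `κ = 2` reproduces deposit 8 -/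

/-- `κ = 2` (`slab_gronwall_two`) reproduces deposit 8's strict floor `vorticityRate_witness_const_gt_quarter` verbatim.
[cite: KochNadirashviliSereginSverak2009, Thms 6.1–6.2] -/
example (hν : 0 < ν) (hT : 0 < T) (hmax : IsMaximalSmoothSolution ν 0 u p T)
    (hLH : IsLerayHopfOn T ν 0 (u 0) u) (hdec : HasRapidSpatialDecay (u 0)) (haxi : IsAxisymmetric (u 0)) {C : ℝ}
    (hrate : ∀ᶠ t in 𝓝[<] T, ∀ x : EuclideanSpace ℝ (Fin 3), (T - t) * ‖curl (u t) x‖ ≤ C) : 1 / 4 < C := by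
  have hreg := hasBoundedSobolevNormsOn_before_of_lerayHopf_classical hν hT hmax.1 hLH hdec
  have h := vorticityRate_witness_const_gt_of_slab hν hT hmax hLH hdec haxi (by norm_num : (0 : ℝ) < 2)
    (slab_gronwall_two hν hmax.1 hreg) hrate
  norm_num at h
  exact h

/-- Conversely deposit 8's strict floor closes the `κ = 2` goal by `exact`.
[cite: KochNadirashviliSereginSverak2009, Thms 6.1–6.2] -/
example (hν : 0 < ν) (hT : 0 < T) (hmax : IsMaximalSmoothSolution ν 0 u p T)
    (hLH : IsLerayHopfOn T ν 0 (u 0) u) (hdec : HasRapidSpatialDecay (u 0)) (haxi : IsAxisymmetric (u 0)) {C : ℝ}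
    (hrate : ∀ᶠ t in 𝓝[<] T, ∀ x : EuclideanSpace ℝ (Fin 3), (T - t) * ‖curl (u t) x‖ ≤ C) :
    1 / (2 * (2 : ℝ)) < C := by
  rw [show (1 : ℝ) / (2 * 2) = 1 / 4 by norm_num]
  exact vorticityRate_witness_const_gt_quarter hν hT hmax hLH hdec haxi hrate

end Summit.NavierStokesRegularity.NavierStokesRegularity.Theorems.CertifiedBlowupVorticityRateBlowup.SlabFloor

end
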